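import Literature.AlgebraicGeometry.KTheory.Determinant
import Literature.AlgebraicGeometry.KTheory.EulerCharacteristic
import HarnessLib

/-!
# The determinant class `det E = det χ(E) ∈ Ȟ¹(X, 𝒪_X^×)` of a complex of vector bundles

Layer `Literature/AlgebraicGeometry/KTheory`, namespace `Literature.AlgebraicGeometry.KTheory`. ONE REAL
DEFINITION and theorems; NO named fact, NO instance, NO notation.

For a scheme `X` and a cochain complex `E` of `𝒪_X`-modules with finite locally free terms (a bounded
complex of vector bundles, `KTheory.IsBoundedVBComplex`), the **determinant class**
`detClassC E hE := det χ(E)` is the composition of the Euler characteristic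
`χ(E) = Σ_i (−1)^i [Eⁱ] ∈ K₀(X)` (`KTheory.eulerChar`, `KTheory/EulerCharacteristic`, Schlichting
Exercise 3.1.4) with the determinant homomorphism `det : K₀(X) → Ȟ¹(X, 𝒪_X^×)` (`KZero.det`,
`KTheory/Determinant`, Hartshorne II Ex. 6.11), valued in the Čech Picard group `CechPic X`
(`Modules/UnitCocycle`). It is the class of the Knudsen–Mumford determinant line bundle
`⊗_i (det Eⁱ)^{(−1)^i}` of a bounded complex of vector bundles, and everything below is a one-line
consequence of the tree's theory of `χ` and `det`:

* `detClassC_single` — `det M[j] = (det M)^{(−1)^j}`;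
* `detClassC_eq_of_iso` — `det` depends only on the isomorphism classes of the terms;
* `detClassC_eq_mul_of_shortExact`, `detClassC_mappingCone` — multiplicativity;
* `detClassC_eq_of_quasiIso` — **invariance under quasi-isomorphism** of bounded complexes of vector
  bundles (through `IsBoundedVBComplex.eulerChar_eq_of_quasiIso`);
* `detClassC_pullback` — `det (f^*E) = f^*(det E)` (`map_eulerChar`, `KZero.det_map`).

Deliberately NOT here: the determinant as a graded line bundle with its sign rules (Knudsen–Mumford),
determinants of perfect complexes that are not strictly bounded complexes of vector bundles.

## References

* R. Hartshorne, *Algebraic Geometry*, GTM 52 (1977), II Ex. 6.11 (`det : K(X) → Pic X`), II Ex. 6.8.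
  [Hartshorne1977]
* M. Schlichting, *Higher algebraic K-theory (after Quillen, Thomason and others)*, LNM 2008 (2011),
  §3.1.3, Exercise 3.1.4. [Schlichting2011HigherKTheory]
* F. Knudsen, D. Mumford, *The projectivity of the moduli space of stable curves I: preliminaries on
  "det" and "Div"*, Math. Scand. 39 (1976) (the determinant of a perfect complex; context only).
  [KnudsenMumford1976]
-/

noncomputable section

open CategoryTheory AlgebraicGeometry

universe u

namespace Literature.AlgebraicGeometry.KTheory

open Literature.AlgebraicGeometry.Motives Literature.AlgebraicGeometry.Modules

variable {X Y : Scheme.{u}}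

/-- **The determinant class of a complex of vector bundles**,
`det E := det χ(E) = ∏_i [det Eⁱ]^{(−1)^i} ∈ Ȟ¹(X, 𝒪_X^×)`: the composition of the Euler characteristic
`χ(E) = Σ (−1)^i [Eⁱ] ∈ K₀(X)` of a cochain complex with finite locally free terms
(`KTheory.eulerChar`; by its convention `χ = 0`, hence `det = 1`, when infinitely many terms are
non-zero) with the determinant homomorphism `det : K₀(X) → Ȟ¹(X, 𝒪_X^×)` (`KZero.det`, Hartshorne II
Ex. 6.11). This is the class of the Knudsen–Mumford determinant line bundle `⊗_i (det Eⁱ)^{(−1)^i}`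
of a bounded complex of vector bundles. [cite: Hartshorne1977, II Ex. 6.11] -/
def detClassC (E : CochainComplex X.Modules ℤ) (hE : ∀ i, IsFiniteLocallyFree (E.X i)) : CechPic X :=
  Additive.toMul (KZero.det (eulerChar E hE))

/-- **`det M[j] = (det M)^{(−1)^j}`**, in particular `det M[0] = det M`. [cite: Hartshorne1977, II Ex. 6.11] -/
theorem detClassC_single (M : X.Modules) (hM : IsFiniteLocallyFree M) (j : ℤ)
    (h : ∀ i, IsFiniteLocallyFree
      (((HomologicalComplex.single X.Modules (ComplexShape.up ℤ) j).obj M).X i)) :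
    detClassC ((HomologicalComplex.single X.Modules (ComplexShape.up ℤ) j).obj M) h =
      detClass hM ^ ((j.negOnePow : ℤˣ) : ℤ) := by
  unfold detClassC
  rw [eulerChar_single M hM j h, map_zsmul, KZero.det_of, toMul_zsmul, toMul_ofMul]

/-- `det E = det χ(E)` depends only on the isomorphism classes of the terms: degreewise isomorphic
complexes have the same determinant class. [cite: Hartshorne1977, II Ex. 6.11] -/
theorem detClassC_eq_of_iso {K L : CochainComplex X.Modules ℤ} (hK : ∀ i, IsFiniteLocallyFree (K.X i))
    (hL : ∀ i, IsFiniteLocallyFree (L.X i)) (e : ∀ i, K.X i ≅ L.X i) :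
    detClassC K hK = detClassC L hL := by
  unfold detClassC
  rw [eulerChar_eq_of_iso hK hL e]

/-- **Additivity**: for a degreewise short exact sequence `0 → K₁ → K₂ → K₃ → 0` of bounded complexes
of vector bundles, `det K₂ = det K₁ · det K₃`. [cite: Schlichting2011HigherKTheory, Exercise 3.1.4] -/
theorem detClassC_eq_mul_of_shortExact {S : ShortComplex (CochainComplex X.Modules ℤ)}
    (h₁ : IsBoundedVBComplex S.X₁) (h₂ : IsBoundedVBComplex S.X₂) (h₃ : IsBoundedVBComplex S.X₃)
    (hS : ∀ i, (S.map (HomologicalComplex.eval _ _ i)).ShortExact) :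
    detClassC S.X₂ h₂.isFiniteLocallyFree =
      detClassC S.X₁ h₁.isFiniteLocallyFree * detClassC S.X₃ h₃.isFiniteLocallyFree := by
  unfold detClassC
  rw [eulerChar_eq_add_of_shortExact h₁ h₂ h₃ hS, map_add, toMul_add]

/-- **`det Cone(φ) = det L / det K`** for a morphism `φ : K ⟶ L` of bounded complexes of vector
bundles. [cite: Schlichting2011HigherKTheory, §3.1.3] -/
theorem detClassC_mappingCone {K L : CochainComplex X.Modules ℤ} (hK : IsBoundedVBComplex K)
    (hL : IsBoundedVBComplex L) (φ : K ⟶ L) :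
    detClassC (CochainComplex.mappingCone φ) (hK.mappingCone hL φ).isFiniteLocallyFree =
      detClassC L hL.isFiniteLocallyFree / detClassC K hK.isFiniteLocallyFree := by
  unfold detClassC
  rw [eulerChar_mappingCone hK hL φ, map_sub, toMul_sub]

/-- **Quasi-isomorphic bounded complexes of vector bundles have the same determinant class** (the
determinant of a perfect complex is an invariant of the derived category).
[cite: Schlichting2011HigherKTheory, Exercise 3.1.4] -/
theorem detClassC_eq_of_quasiIso {K L : CochainComplex X.Modules ℤ} (hK : IsBoundedVBComplex K)
    (hL : IsBoundedVBComplex L) (φ : K ⟶ L) [QuasiIso φ] :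
    detClassC K hK.isFiniteLocallyFree = detClassC L hL.isFiniteLocallyFree := by
  unfold detClassC
  rw [hK.eulerChar_eq_of_quasiIso hL φ]

/-- **`det (f^*E) = f^*(det E)`** in `Ȟ¹(Y, 𝒪_Y^×)` for `f : Y ⟶ X` and a bounded complex of vector
bundles `E` on `X`. [cite: Hartshorne1977, II Ex. 6.8] -/
theorem detClassC_pullback (f : Y ⟶ X) {K : CochainComplex X.Modules ℤ} (hK : IsBoundedVBComplex K) :
    detClassC (((Scheme.Modules.pullback f).mapHomologicalComplex _).obj K)
        (hK.pullback f).isFiniteLocallyFree =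
      CechPic.pullback f (detClassC K hK.isFiniteLocallyFree) := by
  unfold detClassC
  rw [← map_eulerChar f hK, KZero.det_map, toMul_ofMul]

end Literature.AlgebraicGeometry.KTheory

end
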